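import Literature.AnabelianGeometry.AbsoluteAnabelian.AbsTopII.BelyiCuspidalizationChainU
import Literature.AnabelianGeometry.AbsoluteAnabelian.AbsTopII.BelyiCuspidalizationContentSchemaScope
import HarnessLib

/-!
# [AbsTopII] Cor 3.7 with the content of (a), v2 (`BelyiModel.Cor_3_7''`, `U`-slot per Ex 3.6 (i)):
# the separation / scope certificate of F-f064-1 PORTED to the v2 predicate (abc-iut-L4-lead RULING #7s)

S. Mochizuki, *Topics in Absolute Anabelian Geometry II: Decomposition Groups and Endomorphisms*
[AbsTopII] (bib key `MochizukiAbsTopII2013`; manuscript pagination, lit key `paper:url-585b8d0ad0d9`):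
Example 3.6 pp. 71–72, Corollary 3.7 pp. 72–73; [AbsTopI] (`MochizukiAbsTopI2012`) Def 4.2 (iii)
pp. 49–50 ((3_Π): cuspidal decomposition groups come from cusps OF `X`; (c): type •).

PROOF-ONLY companion (no definition, no instance, no structure) of abc-iut-L4-t6's
`AbsTopII/BelyiCuspidalizationChainU.lean` (`BelyiCuspidalization.RealizesChain'`, `BelyiModel.Cor_3_7''`:
the v2 of the F-f064-1 repair with the `U`-slot at `s + m = t` and the `W`-slot at `w + n = s` —
finding F-f067g2-1, abc-iut-f-067 / CONCUR abc-iut-f-064, RULING #7s), cell abc-iut, seat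
abc-iut-f-064 (author of F-f064-1).  PORT of `BelyiCuspidalizationContentSchemaScope.lean` (p434894,
the same certificate for v1 `Cor_3_7'`), whose predicate-independent lemmas are imported and reused
BY NAME (`ChainGroup.not_isDeCuspVia_of_isEmpty`, `BelyiCuspidalization.cusp_arith_injective_of_projU_injective`,
`Cuspidalization.IsoOver.injective_right`, `BelyiModel.cor_3_7_of_isSlimGroup_cuspOf_geom`).  The
argument is slot-independent: with NO cusp recorded on `X` no step of type • exists, so the block
from the `U`-slot to `t` is empty WHEREVER the `U`-slot sits.  PROVED here:

* `BelyiModel.exists_separation_model` — the junk class/model over the REAL field `ℚ_2` of p429725 /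
  p434894 as ONE predicate-agnostic ∃-theorem (universe `0`): chain-full, rel-isom-DGC, every member
  `Π := G × G ↠ G` (`G := Gal(ℚ̄_2/ℚ_2)`) satisfying `IsCor37Member` UNCONDITIONALLY, NO cusp recorded
  on any member, every member with an NF-open, every NF-open with SLIM `Δ_{U_X} ≅ G × G` and
  `Π_{U_X}` and a NON-injective cuspidalization `(G × G) × G ↠ G × G` — so that any future variant of
  the content predicate is separated from the frozen `Cor_3_7` by its kernel form alone;
* `BelyiCuspidalization.RealizesChain'.projU_injective_of_isEmpty` (`.nonempty_cusp_of_not_injective`) —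
  at empty cuspidal data a v2-realized chain has `s = t` and `Π_U ↠ Π_V` injective;
* `BelyiModel.not_cor_3_7''_of_isEmpty_cusp` (KERNEL FORM: the v2 predicate consumes `M.cusps b X`),
  `Cor_3_7''.cuspOf_injective_of_isEmpty_cusp`, `cor_3_7''_of_isEmpty_nfOpen` (vacuous instance form;
  the non-vacuous one is the sibling `BelyiCuspidalizationChainUPointPreserving.lean`);
* `BelyiModel.exists_cor_3_7_and_not_cor_3_7'_and_not_cor_3_7''` — the separation model satisfies the
  frozen `Cor_3_7` and violates BOTH content predicates; `not_forall_cor_3_7''_of_isSlimGroup_cuspOf_geom`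
  (v2 is NOT implied by the classical input that implies `Cor_3_7`), `not_forall_cor_3_7''_of_cor_3_7`,
  `not_forall_cor_3_7''` (universal closure refuted: a HYPOTHESIS ON `(𝒟, M)`, bindable per instance).

READING (honest framing): statements about OUR typed interface; the separation model records no cusp on
a member "of strictly Belyi type" and lets an NF-open identify points — free model data no étale `π₁`
would supply (FOUNDATIONS row 12).  NOTHING in print is contradicted; refuted-as-schema ≠
refuted-in-print; no side taken on [IUTchIII] Cor 3.12; typed ≠ proved.
-/

open CategoryTheory Topology
open scoped Pointwise

universe u

namespace Literature.AnabelianGeometry.AbsoluteAnabelian.AbsTopII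

open Literature.AlgebraicGeometry.Frobenioids (IsSlimGroup)
open FundamentalExtension
open AbsTopI (ConstructionDataClass)
open AbsTopIII (IsGeneralizedSubpadicFor IsSubpadicFor cyclotomicChar)

/-! ## The separation model, once and for all -/

/-- **The SEPARATION MODEL, predicate-agnostic** (universe `0`): a class `𝒟` over the REAL field `ℚ_2`
that is chain-full with rel-isom-DGC, and a model `M` over it such that EVERY member satisfies the
standing hypotheses of Cor 3.7 (`IsCor37Member`, unconditionally: [Tpcs] Lem 4.14 / [AbsTopI] Ex 4.8
(i) kernel theorems), has NO recorded cusp, and has an NF-open — every NF-open having SLIM `Δ_{U_X}`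
and `Π_{U_X}` and a cuspidalization `Π_{U_X} ↠ Π` that is NOT injective (the first projection
`(G × G) × G ↠ G × G`, `G := Gal(ℚ̄_2/ℚ_2)`).  Every "the •-tail computes `Π_U ↠ Π_V`" variant of the
repaired Cor 3.7 fails here by its kernel form, while the frozen `Cor_3_7` holds
(`cor_3_7_of_isSlimGroup_cuspOf_geom`). [cite: MochizukiAbsTopII2013, Cor 3.7 pp.72-73] -/
theorem BelyiModel.exists_separation_model :
    ∃ (𝒟 : ConstructionDataClass.{0}) (M : BelyiModel 𝒟) (b : 𝒟.Base) (X : (𝒟.datum b).Obj)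
      (_ : M.NFOpen b X),
      𝒟.IsChainFull ∧ 𝒟.RelIsomDGC ∧
      (∀ (b : 𝒟.Base) (X : (𝒟.datum b).Obj), M.IsCor37Member b X) ∧
      (∀ (b : 𝒟.Base) (X : (𝒟.datum b).Obj), IsEmpty (M.cusps b X).Cusp) ∧
      (∀ (b : 𝒟.Base) (X : (𝒟.datum b).Obj) (U : M.NFOpen b X),
        IsSlimGroup (M.cuspOf U).ext.geom ∧ IsSlimGroup (M.cuspOf U).ext.arith ∧
          ¬ Function.Injective (M.cuspOf U).hom.arith) := by
  let Γ : ProfiniteGrp.{0} := absoluteGaloisGrp ℚ_[2]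
  -- the member: `Π := G × G ↠ G` (second projection)
  let P : AugmentedProfiniteGrp Γ :=
    { arith := ProfiniteGrp.of (Γ × Γ), aug := ContinuousMonoidHom.snd Γ Γ
      aug_surjective := fun g => ⟨(1, g), rfl⟩ }
  let D : RelativeAnabelianDatum Γ :=
    { Obj := Bool
      Hom := fun _ _ => {q : AugmentedProfiniteGrp.OuterHom P P // q.IsIso}
      IsIso := fun _ => True
      IsHyperbolicCurve := fun _ => True
      primes := Set.univ
      grp := fun _ => P
      outerHom := fun q => q.1 }
  let 𝒟 : ConstructionDataClass.{0} :=
    { Base := PUnit.{1}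
      fld := fun _ => ℚ_[2]
      instField := fun _ => inferInstance
      instCharZero := fun _ => inferInstance
      datum := fun _ => D
      Mem := fun _ _ => True
      IsHyperbolicOrbicurve := fun _ _ => True
      isHyperbolicOrbicurve_of_isHyperbolicCurve := fun _ _ _ => trivial
      chainTerms := fun _ _ => ∅ }
  let E₀ : FundamentalExtension.{0} := P.toExtension
  let C₀ : CuspidalData E₀ :=
    { Cusp := PEmpty.{1}
      Dcusp := fun x => x.elim
      Icusp := fun x => x.elim
      Icusp_eq := fun x => x.elim
      isClosed_Dcusp := fun x => x.elim
      eq_of_conj := fun x => x.elim }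
  -- the junk cuspidalization `Π_{U_X} := (G × G) × G ↠ G × G` (first projection), SLIM
  let E₁ : FundamentalExtension.{0} :=
    { arith := ProfiniteGrp.of ((Γ × Γ) × Γ), gal := Γ
      aug := (ContinuousMonoidHom.snd Γ Γ).comp (ContinuousMonoidHom.fst (Γ × Γ) Γ)
      aug_surjective := fun g => ⟨((1, g), 1), rfl⟩ }
  let f : E₁ ⟶ E₀ := ⟨ContinuousMonoidHom.fst (Γ × Γ) Γ, ContinuousMonoidHom.id Γ, fun _ => rfl⟩
  let c : Cuspidalization E₀ := ⟨E₁, f, fun g => ⟨(g, 1), rfl⟩, Function.bijective_id⟩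
  let C₁ : CuspidalData E₁ :=
    { Cusp := PEmpty.{1}
      Dcusp := fun x => x.elim
      Icusp := fun x => x.elim
      Icusp_eq := fun x => x.elim
      isClosed_Dcusp := fun x => x.elim
      eq_of_conj := fun x => x.elim }
  let M : BelyiModel 𝒟 :=
    { cusps := fun _ _ => C₀
      IsStrictlyBelyiType := fun _ _ => True
      NFOpen := fun _ _ => PUnit.{1}
      cuspOf := fun _ => c
      cuspsOf := fun _ => C₁ }
  have hfull : 𝒟.IsChainFull := fun _ _ _ _ ht => ((Set.mem_empty_iff_false _).mp ht).elim
  have hGC : 𝒟.RelIsomDGC := fun _ _ _ _ _ =>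
    ⟨fun q _ => q.2, fun q _ q' _ h => Subtype.ext h, fun q hq => ⟨⟨q, hq⟩, trivial, rfl⟩⟩
  have hk : IsGeneralizedSubpadicFor ℚ_[2] 2 := (IsSubpadicFor.padic 2).isGeneralizedSubpadicFor
  have hΓ : IsSlimGroup Γ :=
    isSlimGroup_of_iso_absoluteGaloisGrp_of_isGeneralizedSubpadicFor_holds hk (Iso.refl _)
  -- `Δ = G × 1 ≅ G` is slim …
  let e : Γ ≃ₜ* ↥E₀.geom :=
    { toFun := fun g => ⟨(g, 1), rfl⟩
      invFun := fun x => x.1.1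
      left_inv := fun _ => rfl
      right_inv := fun x => by
        obtain ⟨⟨g, h⟩, hx⟩ := x
        have hh : h = 1 := hx
        subst hh
        rfl
      map_mul' := fun g h => Subtype.ext (Prod.ext rfl (one_mul (1 : Γ)).symm)
      continuous_toFun := Continuous.subtype_mk (continuous_id.prodMk continuous_const) _
      continuous_invFun := continuous_fst.comp continuous_subtype_val }
  have hΔ : IsSlimGroup ↥E₀.geom := isSlimGroup_of_continuousMulEquiv e hΓ
  -- … and nontrivial
  haveI : Infinite (Field.absoluteGaloisGroup ℚ_[2]) := Padic.infinite_absoluteGaloisGroup 2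
  obtain ⟨σ, hσ⟩ := exists_ne (1 : Field.absoluteGaloisGroup ℚ_[2])
  have hne : E₀.geom ≠ ⊥ := by
    intro h
    have hmem : ((σ, 1) : Γ × Γ) ∈ E₀.geom := rfl
    rw [h] at hmem
    exact hσ (Prod.mk_eq_one.mp (Subgroup.mem_bot.mp hmem)).1
  have hX : ∀ X : Bool, M.IsCor37Member PUnit.unit X := fun X =>
    M.isCor37Member_of_isGeneralizedSubpadicFor trivial rfl trivial hk hΔ hne
  -- `Π = G × G` is slim ([AbsAnab] Lem 1.3.1), hence so is `Δ_{U_X} = G × 1 × G ≅ G × G` …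
  have hPi : IsSlimGroup (Γ × Γ) := (hX true).arith_slim
  let e₁ : (Γ × Γ) ≃ₜ* ↥E₁.geom :=
    { toFun := fun g => ⟨((g.1, 1), g.2), rfl⟩
      invFun := fun x => (x.1.1.1, x.1.2)
      left_inv := fun _ => rfl
      right_inv := fun x => by
        obtain ⟨⟨⟨g, h⟩, k⟩, hx⟩ := x
        have hh : h = 1 := hx
        subst hh
        rfl
      map_mul' := fun g h => Subtype.ext (Prod.ext (Prod.ext rfl (one_mul (1 : Γ)).symm) rfl)
      continuous_toFun := Continuous.subtype_mk
        ((continuous_fst.prodMk continuous_const).prodMk continuous_snd) _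
      continuous_invFun := (continuous_fst.comp (continuous_fst.comp continuous_subtype_val)).prodMk
        (continuous_snd.comp continuous_subtype_val) }
  have hΔ₁ : IsSlimGroup ↥E₁.geom := isSlimGroup_of_continuousMulEquiv e₁ hPi
  -- … and `Π_{U_X}` is slim ([AbsAnab] Lem 1.3.1 again)
  have hPi₁ : IsSlimGroup E₁.arith := E₁.arith_slim_of_geom_slim_of_gal_slim hΔ₁ hΓ
  -- `Π_{U_X} ↠ Π` kills the nontrivial element `((1, 1), σ)`
  have hninj : ¬ Function.Injective c.hom.arith := by
    intro hinj
    have h1 : c.hom.arith (((1, 1), σ) : (Γ × Γ) × Γ) = c.hom.arith 1 := rfl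
    exact hσ (Prod.mk_eq_one.mp (hinj h1)).2
  exact ⟨𝒟, M, PUnit.unit, true, PUnit.unit, hfull, hGC, fun _ X => hX X,
    fun _ _ => inferInstanceAs (IsEmpty PEmpty.{1}), fun _ _ _ => ⟨hΔ₁, hPi₁, hninj⟩⟩

/-! ## What `RealizesChain'` forces when no cusp of `X` is recorded -/

namespace BelyiCuspidalization

variable {E : FundamentalExtension.{u}} {C : CuspidalData E} {hP : IsSlimGroup E.arith}
  {hΔ : IsSlimGroup E.geom} {hne : E.geom ≠ ⊥}

/-- **An output v2-realizing a chain relative to EMPTY cuspidal data has `Π_U ↠ Π_V` injective**: every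
step `Πⱼ ⇝ Πⱼ₊₁` with `s ≤ j < t` (the `m` steps "`U ⇝ U_m ⇝ ⋯ ⇝ U_1 = V`") is of type •; with no cusp
recorded no such step exists (`ChainGroup.not_isDeCuspVia_of_isEmpty`), so `s = t`, the tracked
composite `ψ_t` is the isomorphism `Π_U ⥲ Π_s`, and `Π_U ↠ Π_V`, read through `Π_t ⥲ Π_V ⊆ Π`, is a
composite of isomorphisms (slot-independent form of p434894's v1 lemma; abc-iut-L4-t6's
`RealizesChain'.projU_injective_of_m_eq_zero` is the `m = 0` form). [cite: MochizukiAbsTopII2013, Cor 3.7 (a) p.73] -/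
theorem RealizesChain'.projU_injective_of_isEmpty {B : BelyiCuspidalization E}
    (h : B.RealizesChain' C hP hΔ hne) (hC : IsEmpty C.Cusp) : Function.Injective B.projU.arith := by
  obtain ⟨c, -, -, w, s, t, -, hst, ht, eU, eV, -, -, ψ, -, -, hψs, htail, hlast⟩ := h
  -- the •-block `U ⇝ ⋯ ⇝ V` is empty: a step of type • would need a cusp of `X`
  have hts : t.val = s.val := by
    by_contra hts
    have hlt : s.val < t.val := by omega
    have hsl : s.val < c.len := by omega
    obtain ⟨φ, hφ, -⟩ := htail ⟨s.val, hsl⟩ le_rfl hlt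
    exact ChainGroup.not_isDeCuspVia_of_isEmpty C hC _ _ φ hφ
  obtain rfl : t = s := Fin.ext hts
  intro x y hxy
  have hx := hlast x
  have hy := hlast y
  rw [hψs] at hx hy
  rw [← hx, ← hy] at hxy
  exact eU.injective (eV.symm.injective (Subtype.val_injective hxy))

/-- Contrapositive: an output whose `Π_U ↠ Π_V` identifies two elements v2-realizes a `Π`-chain only if
some cusp of `X` is recorded. [cite: MochizukiAbsTopII2013, Cor 3.7 (a) p.73] -/
theorem RealizesChain'.nonempty_cusp_of_not_injective {B : BelyiCuspidalization E}
    (h : B.RealizesChain' C hP hΔ hne) (hU : ¬ Function.Injective B.projU.arith) :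
    Nonempty C.Cusp := by
  rw [← not_isEmpty_iff]
  exact fun hC => hU (h.projU_injective_of_isEmpty hC)

end BelyiCuspidalization

/-! ## `Cor_3_7''` consumes the cuspidal data of `X` -/

variable {𝒟 : ConstructionDataClass.{u}}

namespace BelyiModel

variable (M : BelyiModel 𝒟)

/-- **KERNEL FORM of "the v2 repair consumes `M.cusps b X`"**: over a chain-full class with rel-isom-DGC,
a member `X` satisfying the standing hypotheses of Cor 3.7 with NO recorded cusp and an NF-open `U_X`
whose `Π_{U_X} ↠ Π` is not injective violates `Cor_3_7''` — whatever the slimness of `Π_{U_X}`.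
[cite: MochizukiAbsTopII2013, Cor 3.7 pp.72-73] -/
theorem not_cor_3_7''_of_isEmpty_cusp (hfull : 𝒟.IsChainFull) (hGC : 𝒟.RelIsomDGC)
    {b : 𝒟.Base} {X : (𝒟.datum b).Obj} (h : M.IsCor37Member b X)
    (hC : IsEmpty (M.cusps b X).Cusp) (U : M.NFOpen b X)
    (hU : ¬ Function.Injective (M.cuspOf U).hom.arith) : ¬ M.Cor_3_7'' := by
  intro h37
  obtain ⟨B, hiso, -, hreal⟩ := h37 hfull hGC b X h U
  exact hU (hiso.injective_right
    (B.cusp_arith_injective_of_projU_injective (hreal.projU_injective_of_isEmpty hC)))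

/-- Under `Cor_3_7''` an NF-open of a member with no recorded cusp removes no point.
[cite: MochizukiAbsTopII2013, Cor 3.7 pp.72-73] -/
theorem Cor_3_7''.cuspOf_injective_of_isEmpty_cusp {M : BelyiModel 𝒟} (h37 : M.Cor_3_7'')
    (hfull : 𝒟.IsChainFull) (hGC : 𝒟.RelIsomDGC) {b : 𝒟.Base} {X : (𝒟.datum b).Obj}
    (h : M.IsCor37Member b X) (hC : IsEmpty (M.cusps b X).Cusp) (U : M.NFOpen b X) :
    Function.Injective (M.cuspOf U).hom.arith := by
  by_contra hU
  exact M.not_cor_3_7''_of_isEmpty_cusp hfull hGC h hC U hU h37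

/-- Instance form that holds VACUOUSLY: a model none of whose members has an NF-rational open
satisfies `Cor_3_7''`. [cite: MochizukiAbsTopII2013, Cor 3.7 pp.72-73] -/
theorem cor_3_7''_of_isEmpty_nfOpen
    (h : ∀ (b : 𝒟.Base) (X : (𝒟.datum b).Obj), IsEmpty (M.NFOpen b X)) : M.Cor_3_7'' :=
  fun _ _ b X _ U => (h b X).elim U

end BelyiModel

/-! ## The regression certificate, v2: `Cor_3_7` holds, `Cor_3_7'` and `Cor_3_7''` fail -/

/-- **REGRESSION CERTIFICATE for F-f064-1, v2** (universe `0`): on the separation model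
(`exists_separation_model`) the frozen `Cor_3_7` HOLDS (slim `Δ_{U_X}` — the witness of F-f064-1),
while BOTH content predicates — v1 `Cor_3_7'` (`W`-slot typing, p432148) and v2 `Cor_3_7''` (`U`-slot,
RULING #7s) — FAIL by their kernel forms (no cusp recorded, a point removed).
[cite: MochizukiAbsTopII2013, Cor 3.7 pp.72-73] -/
theorem BelyiModel.exists_cor_3_7_and_not_cor_3_7'_and_not_cor_3_7'' :
    ∃ (𝒟 : ConstructionDataClass.{0}) (M : BelyiModel 𝒟),
      (∀ (b : 𝒟.Base) (X : (𝒟.datum b).Obj), M.IsCor37Member b X → ∀ U : M.NFOpen b X,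
        IsSlimGroup (M.cuspOf U).ext.geom) ∧
      M.Cor_3_7 ∧ ¬ M.Cor_3_7' ∧ ¬ M.Cor_3_7'' := by
  obtain ⟨𝒟, M, b, X, U, hfull, hGC, hX, hC, hU⟩ := BelyiModel.exists_separation_model
  exact ⟨𝒟, M, fun b X _ U => (hU b X U).1,
    M.cor_3_7_of_isSlimGroup_cuspOf_geom fun b X _ U => (hU b X U).1,
    M.not_cor_3_7'_of_isEmpty_cusp hfull hGC (hX b X) (hC b X) U (hU b X U).2.2,
    M.not_cor_3_7''_of_isEmpty_cusp hfull hGC (hX b X) (hC b X) U (hU b X U).2.2⟩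

/-- **The v2 repair bites: `Cor_3_7''` is NOT implied by the classical input that implies the frozen
`Cor_3_7`** (slim `Δ_{U_X}`, `BelyiModel.cor_3_7_of_isSlimGroup_cuspOf_geom`).
[cite: MochizukiAbsTopII2013, Cor 3.7 pp.72-73] -/
theorem BelyiModel.not_forall_cor_3_7''_of_isSlimGroup_cuspOf_geom :
    ¬ ∀ (𝒟 : ConstructionDataClass.{0}) (M : BelyiModel 𝒟),
      (∀ (b : 𝒟.Base) (X : (𝒟.datum b).Obj), M.IsCor37Member b X → ∀ U : M.NFOpen b X,
        IsSlimGroup (M.cuspOf U).ext.geom) → M.Cor_3_7'' := by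
  intro H
  obtain ⟨𝒟, M, hslim, -, -, h37⟩ := BelyiModel.exists_cor_3_7_and_not_cor_3_7'_and_not_cor_3_7''
  exact h37 (H 𝒟 M hslim)

/-- In particular the frozen `Cor_3_7` does NOT imply `Cor_3_7''` schematically (the converse is
abc-iut-L4-t6's `cor_3_7_of_cor_3_7''`). [cite: MochizukiAbsTopII2013, Cor 3.7 pp.72-73] -/
theorem BelyiModel.not_forall_cor_3_7''_of_cor_3_7 :
    ¬ ∀ (𝒟 : ConstructionDataClass.{0}) (M : BelyiModel 𝒟), M.Cor_3_7 → M.Cor_3_7'' := by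
  intro H
  obtain ⟨𝒟, M, -, h37, -, h37''⟩ := BelyiModel.exists_cor_3_7_and_not_cor_3_7'_and_not_cor_3_7''
  exact h37'' (H 𝒟 M h37)

/-- **Universal closure of the v2 predicate REFUTED** (universe `0`): `BelyiModel.Cor_3_7''` is — like
`Cor_3_7` (F-0232) and `Cor_3_7'` — a HYPOTHESIS ON `(𝒟, M)`, bindable per instance (the étale-`π₁`
class of [AbsTopI] Ex 4.8 (i)), not a closed fact.  Cor 3.7 itself is not touched.
[cite: MochizukiAbsTopII2013, Cor 3.7 pp.72-73] -/
theorem BelyiModel.not_forall_cor_3_7'' :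
    ¬ ∀ (𝒟 : ConstructionDataClass.{0}) (M : BelyiModel 𝒟), M.Cor_3_7'' := by
  intro H
  obtain ⟨𝒟, M, -, -, -, h37''⟩ := BelyiModel.exists_cor_3_7_and_not_cor_3_7'_and_not_cor_3_7''
  exact h37'' (H 𝒟 M)

end Literature.AnabelianGeometry.AbsoluteAnabelian.AbsTopII
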